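import Mathlib
import HarnessLib
import Summits.Parity.GeneralizedHardyLittlewood.Theses.LiouvilleShiftedTables
import Summits.Parity.GeneralizedHardyLittlewood.Theorems.LiouvilleShiftedTablesBVLiouville
import Literature.NumberTheory.Sieve.SingularSeriesProofs
import Literature.NumberTheory.Sieve.SingularSeriesPairProofs
import Literature.Computability.Complexity.SmallPrimesCRT

/-!
# Disproof work file for crux `EngineToPairs` (stmt-Parity-14659) — cdisprove, gen-1

EngineToPairs (route `LiouvilleShiftedTables`, rank 6, ONE-PIECE GLUE):
`EngineToPairs := DilatedTableChowla → TypeI2Dilated → ElliottHalberstam → PairsHL'` where `PairsHL'`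
is the INLINED fixed-shift Hardy–Littlewood pair asymptotic
`∀ h ≥ 1, Σ_{n ≤ N} Λ(n)Λ(n+h) − 𝔖({0,h})·N = o(N)` (verbatim the route decl `PairsHL`).

## Findings (all `sorry`-free unless marked; section index)

* §0 `pairsHL_iff`, `crux_iff` factor the crux `EngineToPairs` through `Concl h` (one shift) — `Iff.rfl`;
  `crux_iff_pairsHL : EngineToPairs ↔ (X1 → X2 → EH → PairsHL)` — `Iff.rfl`.
* §1 STRUCTURE — why no unconditional kill exists: `crux_of_pairsHL : PairsHL → EngineToPairs` and
  `not_crux_iff : ¬EngineToPairs ↔ X1 ∧ X2 ∧ EH ∧ ¬PairsHL`. A refutation must PROVE both engine cruxes and the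
  Elliott–Halberstam conjecture and DISPROVE Hardy–Littlewood pairs at some fixed shift. Vacuity
  channels `crux_of_not_X1/X2/EH` (a refutation of either engine crux closes this item positively —
  see the sibling files `Cruxes/DilatedTableChowla/Disproof.lean`, `Cruxes/TableChowla/Disproof.lean`:
  both RESIST). Factorisations `crux_of_halves : SieveToMAvg → PairsFromMAvg → EngineToPairs` (over the PROVED
  `BVLiouville`, tree theorem `stub_bvLiouville`) and `crux_of_MAvg : MAvg → PairsFromMAvg → EngineToPairs`.
* §2 (a) LOAD-BEARING ANALYSIS: every hypothesis-drop `WithoutX1`, `WithoutX2`, `WithoutEH` is still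
  implied by `PairsHL` (`without*_of_pairsHL`), so NO `_false_without_` theorem can exist short of
  `¬PairsHL`: the three hypotheses are load-bearing for the PROOF (Heath-Brown/Type-I₂/level-1 sieve),
  not for the TRUTH of the implication. The one droppable-and-refutable clause is the shift condition
  `1 ≤ h`: `not_concl_zero : ¬ Concl 0` (§4b), hence `not_forall_concl` and
  `withoutShiftPos_false_of_hyps : X1 → X2 → EH → ¬WithoutShiftPos`.
* §3 CONSTANT AUDIT (why-might-fail (b) of the planner does not bite): `HL_odd : Odd h → 𝔖({0,h}) = 0`,
  `HL_pos_of_even`, `HL_zero : 𝔖({0,0}) = 𝔖({0}) = 1`, `HL_two : 𝔖({0,2}) = 2C₂`, `one_le_HL_two`,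
  `HL_two_le_HL_even : Even h → h ≠ 0 → 𝔖({0,2}) ≤ 𝔖({0,h})` (factorwise comparison of Euler factors).
* §4 (b) BOUNDARY SHIFTS: `concl_odd : Odd h → Concl h` — the odd-shift half of the conclusion is an
  UNCONDITIONAL THEOREM (`Σ_{n≤N} Λ(n)Λ(n+h) ≤ 2(log₂(N+h)+1) log²(N+h)`, powers of two only), so
  `pairsHL_iff_even`, `crux_iff_even`: provers of `PairsFromMAvg` may assume `h` even.  (The same
  odd-shift theorem was landed independently and simultaneously by the `PairsHL` prover as the TREE theorem
  `Theorems.PairsHL.pairsHL_odd` / `pairsHL_iff_even` in `Theorems/LiouvilleShiftedTablesPairsHLOdd.lean`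
  — IMPORT that one; the copy here is kept only to keep this work file self-contained.)
  `not_concl_zero : ¬ Concl 0` — at `h = 0` the statement reads `Σ Λ² = N + o(N)`, refuted by Chebyshev
  (`Σ_{n≤N} Λ(n)² ≥ N log N / 8` for `N ≥ 2²⁴`, via `θ(N) ≥ N log 2 / 2`): `1 ≤ h` is load-bearing.
* §5 (c) NATURAL STRENGTHENING REFUTED: `not_uniformConcl` — the conclusion cannot hold uniformly in
  the shift (`∀ ε, ∀ᶠ N, ∀ h ≥ 1, |P h N − 𝔖 N| ≤ εN` is FALSE: at `h = (N!)²` one has `P h N = 0`,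
  `P_factorial_sq`, while `𝔖({0,h}) ≥ 2C₂ ≥ 1`). The witness shift is super-exponential in `N`, so it
  does NOT bite the polynomial shift-uniformity `|b_i| ≤ LN` inside `PairsToGHL`; it only records that
  the `o(N)` of the conclusion is necessarily non-uniform in `h` (the `N₀(h, ε)` dependence is real).
* Targets: none yet (payload `stuck_stubs = []`; no line picked for this crux).

LANDING: §3 (values at h = 0, 2; uniform lower bound `𝔖({0,h}) ≥ 2C₂` at even shifts), §4b (`h = 0` false)
and §5 (no uniformity in `h`) are proposed as the importable module
`Theorems/EngineToPairs/Negative/EngineToPairsShiftBoundary.lean` (namespace `…Theorems.EngineToPairs.Negative`,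
stated on the raw `PairsHL` shape, reusing `Theorems.PairsHL.*`).

VERDICT (cycle 1): RESISTS — structurally unkillable (conclusion = HL pairs at fixed shifts; every
weakening is implied by it), formalisation audited (constant, casts, junk at h = 0 / odd h), no loophole.
What provers should take from this file: work the support halves `SieveToMAvg` (stmt-Parity-14274) and
`PairsFromMAvg` (stmt-Parity-14275); the odd-`h` case is free (§4); `𝔖({0,h})` facts of §3 are reusable.
-/

noncomputable section

namespace Summit.Parity.GeneralizedHardyLittlewood.Cruxes.EngineToPairs.Disproof

open Summit.Parity.GeneralizedHardyLittlewood.Theses.LiouvilleShiftedTables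
open Filter Asymptotics Finset
open scoped ArithmeticFunction.vonMangoldt Topology
open Literature.NumberTheory.Sieve

/-! ## §0 The crux, factored -/

/-- The pair-correlation sum `P h N = Σ_{1 ≤ n ≤ N} Λ(n) Λ(n+h)`. -/
def P (h N : ℕ) : ℝ := ∑ n ∈ Icc 1 N, Λ n * Λ (n + h)

/-- The Hardy–Littlewood constant of the pair `{0, h}`: `HL h = 𝔖({0, h})`. -/
def HL (h : ℕ) : ℝ := singularSeries ({0, (h : ℤ)} : Finset ℤ)

/-- The conclusion of the crux at ONE shift `h`: `P h N − 𝔖({0,h})·N = o(N)`. -/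
def Concl (h : ℕ) : Prop :=
  (fun N : ℕ => P h N - HL h * N) =o[atTop] fun N : ℕ => (N : ℝ)

/-- `PairsHL` is `∀ h ≥ 1, Concl h` — by `Iff.rfl`. -/
theorem pairsHL_iff : PairsHL ↔ ∀ h : ℕ, 1 ≤ h → Concl h := Iff.rfl

/-- The crux is `X1 → X2 → EH → PairsHL` — by `Iff.rfl` (the conclusion is `PairsHL` inlined). -/
theorem crux_iff_pairsHL :
    EngineToPairs ↔ (DilatedTableChowla → TypeI2Dilated → ElliottHalberstam → PairsHL) :=
  Iff.rfl

/-- The crux, factored through `Concl` — by `Iff.rfl`. -/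
theorem crux_iff :
    EngineToPairs ↔
      (DilatedTableChowla → TypeI2Dilated → ElliottHalberstam → ∀ h : ℕ, 1 ≤ h → Concl h) :=
  Iff.rfl

/-! ## §1 Structure: what a disproof would have to do -/

/-- The conclusion alone implies the crux: any refutation refutes Hardy–Littlewood pairs. -/
theorem crux_of_pairsHL (hP : PairsHL) : EngineToPairs := fun _ _ _ => hP

/-- `¬EngineToPairs` is EXACTLY `X1 ∧ X2 ∧ EH ∧ ¬PairsHL`. -/
theorem not_crux_iff :
    ¬ EngineToPairs ↔ DilatedTableChowla ∧ TypeI2Dilated ∧ ElliottHalberstam ∧ ¬ PairsHL := by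
  rw [crux_iff_pairsHL]; tauto

/-- Vacuity channel 1: a refutation of the engine crux X1 proves this crux. -/
theorem crux_of_not_X1 (h : ¬ DilatedTableChowla) : EngineToPairs := fun hD => absurd hD h

/-- Vacuity channel 2: a refutation of the engine crux X2 proves this crux. -/
theorem crux_of_not_X2 (h : ¬ TypeI2Dilated) : EngineToPairs := fun _ hI => absurd hI h

/-- Vacuity channel 3: a refutation of Elliott–Halberstam (as formalised) proves this crux. -/
theorem crux_of_not_EH (h : ¬ ElliottHalberstam) : EngineToPairs := fun _ _ hE => absurd hE h

/-- The bridge premise is the verbatim-Mathlib item `EH` — `Iff.rfl`. -/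
theorem elliottHalberstam_iff_EH : ElliottHalberstam ↔ EH := Iff.rfl

/-- The crux is the composition of the two support halves over the PROVED `BVLiouville`. -/
theorem crux_of_halves (hS : SieveToMAvg) (hP : PairsFromMAvg) : EngineToPairs :=
  fun hD hI hE => hP hE (hS hD hI Cruxes.TypeI2Dilated.PeelToDrappeau.stub_bvLiouville)

/-- … and the engine is only used to produce `MAvg`: `MAvg ∧ PairsFromMAvg` already give the crux. -/
theorem crux_of_MAvg (hM : MAvg) (hP : PairsFromMAvg) : EngineToPairs := fun _ _ hE => hP hE hM

/-! ## §2 (a) Load-bearing analysis -/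

/-- The crux with X1 dropped. -/
def WithoutX1 : Prop := TypeI2Dilated → ElliottHalberstam → PairsHL

/-- The crux with X2 dropped. -/
def WithoutX2 : Prop := DilatedTableChowla → ElliottHalberstam → PairsHL

/-- The crux with the bridge premise EH dropped. -/
def WithoutEH : Prop := DilatedTableChowla → TypeI2Dilated → PairsHL

/-- The crux with the shift condition `1 ≤ h` dropped. -/
def WithoutShiftPos : Prop :=
  DilatedTableChowla → TypeI2Dilated → ElliottHalberstam → ∀ h : ℕ, Concl h

theorem withoutX1_of_pairsHL (hP : PairsHL) : WithoutX1 := fun _ _ => hP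
theorem withoutX2_of_pairsHL (hP : PairsHL) : WithoutX2 := fun _ _ => hP
theorem withoutEH_of_pairsHL (hP : PairsHL) : WithoutEH := fun _ _ => hP

theorem not_withoutX1_iff : ¬ WithoutX1 ↔ TypeI2Dilated ∧ ElliottHalberstam ∧ ¬ PairsHL := by
  unfold WithoutX1; tauto
theorem not_withoutX2_iff : ¬ WithoutX2 ↔ DilatedTableChowla ∧ ElliottHalberstam ∧ ¬ PairsHL := by
  unfold WithoutX2; tauto
theorem not_withoutEH_iff : ¬ WithoutEH ↔ DilatedTableChowla ∧ TypeI2Dilated ∧ ¬ PairsHL := by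
  unfold WithoutEH; tauto

theorem crux_of_withoutX1 (h : WithoutX1) : EngineToPairs := fun _ => h
theorem crux_of_withoutX2 (h : WithoutX2) : EngineToPairs := fun hD _ => h hD
theorem crux_of_withoutEH (h : WithoutEH) : EngineToPairs := fun hD hI _ => h hD hI

/-! ## §3 Constant audit: `𝔖({0,h})` -/

theorem pair_zero : ({0, ((0 : ℕ) : ℤ)} : Finset ℤ) = {0} := by simp

theorem tupleResidueCount_singleton_zero (p : ℕ) : tupleResidueCount ({0} : Finset ℤ) p = 1 := by
  simp [tupleResidueCount]

theorem singularSeriesFactor_singleton_zero {p : ℕ} (hp : p.Prime) :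
    singularSeriesFactor ({0} : Finset ℤ) p = 1 := by
  have hp1 : (1 : ℝ) < p := by exact_mod_cast hp.one_lt
  have hne : (1 : ℝ) - 1 / p ≠ 0 := by
    have : (1 : ℝ) / p < 1 := by rw [div_lt_one (by linarith)]; exact hp1
    linarith
  simp only [singularSeriesFactor, tupleResidueCount_singleton_zero, Finset.card_singleton, pow_one,
    Nat.cast_one]
  exact mul_inv_cancel₀ hne

theorem singularSeriesPartial_singleton_zero (x : ℕ) :
    singularSeriesPartial ({0} : Finset ℤ) x = 1 :=
  Finset.prod_eq_one fun _ hp => singularSeriesFactor_singleton_zero (Nat.prime_of_mem_primesLE hp)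

theorem singularSeries_singleton_zero : singularSeries ({0} : Finset ℤ) = 1 := by
  have h : singularSeriesPartial ({0} : Finset ℤ) = fun _ => 1 :=
    funext singularSeriesPartial_singleton_zero
  rw [singularSeries, h]
  exact tendsto_const_nhds.limUnder_eq

/-- `𝔖({0,0}) = 𝔖({0}) = 1`: at the excluded shift `h = 0` the constant is `1`. -/
theorem HL_zero : HL 0 = 1 := by
  rw [HL, pair_zero, singularSeries_singleton_zero]

theorem tupleResidueCount_pair_two_of_odd {h : ℕ} (hh : Odd h) :
    tupleResidueCount ({0, (h : ℤ)} : Finset ℤ) 2 = 2 := by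
  have h1 : ((h : ℤ) : ZMod 2) = 1 := by
    rw [Int.cast_natCast]; exact ZMod.natCast_eq_one_iff_odd.mpr hh
  simp only [tupleResidueCount, Finset.image_insert, Finset.image_singleton, Int.cast_zero, h1]
  decide

theorem not_isAdmissibleTuple_pair_of_odd {h : ℕ} (hh : Odd h) :
    ¬ IsAdmissibleTuple ({0, (h : ℤ)} : Finset ℤ) := by
  intro hadm
  have := hadm 2 Nat.prime_two
  rw [tupleResidueCount_pair_two_of_odd hh] at this
  exact lt_irrefl _ this

/-- Odd shifts: `𝔖({0,h}) = 0` (the factor at `p = 2` vanishes). -/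
theorem HL_odd {h : ℕ} (hh : Odd h) : HL h = 0 := by
  have hnn := singularSeries_nonneg_holds ({0, (h : ℤ)} : Finset ℤ)
  have hnp : ¬ 0 < singularSeries ({0, (h : ℤ)} : Finset ℤ) := fun hpos =>
    not_isAdmissibleTuple_pair_of_odd hh ((singularSeries_pos_iff_holds _).mp hpos)
  exact le_antisymm (not_lt.mp hnp) hnn

theorem tupleResidueCount_pair_two_of_even {h : ℕ} (hh : Even h) :
    tupleResidueCount ({0, (h : ℤ)} : Finset ℤ) 2 = 1 := by
  have h0 : ((h : ℤ) : ZMod 2) = 0 := by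
    rw [Int.cast_natCast]; exact ZMod.natCast_eq_zero_iff_even.mpr hh
  simp only [tupleResidueCount, Finset.image_insert, Finset.image_singleton, Int.cast_zero, h0]
  decide

theorem isAdmissibleTuple_pair_of_even {h : ℕ} (hh : Even h) :
    IsAdmissibleTuple ({0, (h : ℤ)} : Finset ℤ) := by
  rw [isAdmissibleTuple_iff_of_le_card]
  intro p hp hle
  have hcard : ({0, (h : ℤ)} : Finset ℤ).card ≤ 2 := Finset.card_insert_le _ _
  obtain rfl : p = 2 := le_antisymm (hle.trans hcard) hp.two_le
  rw [tupleResidueCount_pair_two_of_even hh]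
  norm_num

/-- Even shifts: `𝔖({0,h}) > 0` (`{0,h}` is admissible). -/
theorem HL_pos_of_even {h : ℕ} (hh : Even h) : 0 < HL h :=
  (singularSeries_pos_iff_holds _).mpr (isAdmissibleTuple_pair_of_even hh)

theorem HL_nonneg (h : ℕ) : 0 ≤ HL h := singularSeries_nonneg_holds _

/-- `𝔖({0,2}) = 2C₂` (tree: `singularSeries_pair_holds`). -/
theorem HL_two : HL 2 = 2 * twinPrimeConst := by
  unfold HL
  push_cast
  exact singularSeries_pair_holds

theorem one_le_HL_two : 1 ≤ HL 2 := by
  rw [HL_two]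
  have := half_le_twinPrimeConst
  linarith

/-- For a prime `p`, `ν_{0,h}(p) ≤ ν_{0,2}(p)` when `h` is even. -/
theorem tupleResidueCount_pair_le {h : ℕ} (hh : Even h) {p : ℕ} (hp : p.Prime) :
    tupleResidueCount ({0, (h : ℤ)} : Finset ℤ) p ≤ tupleResidueCount ({0, 2} : Finset ℤ) p := by
  rcases hp.eq_two_or_odd' with rfl | hodd
  · rw [tupleResidueCount_pair_two_of_even hh]
    have : tupleResidueCount ({0, ((2 : ℕ) : ℤ)} : Finset ℤ) 2 = 1 :=
      tupleResidueCount_pair_two_of_even (by decide)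
    push_cast at this
    omega
  · have h2 : 2 < p := lt_of_le_of_ne hp.two_le (fun h2 => by
      rw [← h2] at hodd; exact (Nat.not_odd_iff_even.mpr (by decide)) hodd)
    rw [tupleResidueCount_pair_of_two_lt h2]
    exact (tupleResidueCount_le_card _ _).trans (Finset.card_insert_le _ _)

/-- Factorwise comparison of Euler factors: `factor_{0,2}(p) ≤ factor_{0,h}(p)` for even `h ≠ 0`. -/
theorem singularSeriesFactor_pair_le {h : ℕ} (hh : Even h) (h0 : h ≠ 0) {p : ℕ} (hp : p.Prime) :
    singularSeriesFactor ({0, 2} : Finset ℤ) p ≤ singularSeriesFactor ({0, (h : ℤ)} : Finset ℤ) p := by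
  have hc2 : ({0, 2} : Finset ℤ).card = 2 := Finset.card_pair (by decide)
  have hch : ({0, (h : ℤ)} : Finset ℤ).card = 2 := Finset.card_pair (by exact_mod_cast h0.symm)
  have hp0 : (0 : ℝ) < p := by exact_mod_cast hp.pos
  have hν : (tupleResidueCount ({0, (h : ℤ)} : Finset ℤ) p : ℝ) ≤
      tupleResidueCount ({0, 2} : Finset ℤ) p := by exact_mod_cast tupleResidueCount_pair_le hh hp
  unfold singularSeriesFactor
  rw [hc2, hch]
  apply mul_le_mul_of_nonneg_right _ (pow_nonneg (inv_nonneg.mpr _) _)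
  · -- 1 - ν₂/p ≤ 1 - ν_h/p
    have := div_le_div_of_nonneg_right hν hp0.le
    linarith
  · rw [sub_nonneg, div_le_one hp0]
    exact_mod_cast hp.one_le

theorem singularSeriesPartial_pair_le {h : ℕ} (hh : Even h) (h0 : h ≠ 0) (x : ℕ) :
    singularSeriesPartial ({0, 2} : Finset ℤ) x ≤ singularSeriesPartial ({0, (h : ℤ)} : Finset ℤ) x :=
  Finset.prod_le_prod (fun _ hp => singularSeriesFactor_nonneg _ (Nat.prime_of_mem_primesLE hp))
    fun _ hp => singularSeriesFactor_pair_le hh h0 (Nat.prime_of_mem_primesLE hp)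

/-- `𝔖({0,2}) ≤ 𝔖({0,h})` for every even `h ≠ 0`; in particular `𝔖({0,h}) ≥ 2C₂ ≥ 1`. -/
theorem HL_two_le_HL_even {h : ℕ} (hh : Even h) (h0 : h ≠ 0) : HL 2 ≤ HL h := by
  have h2 : HL 2 = singularSeries ({0, 2} : Finset ℤ) := by unfold HL; push_cast; rfl
  rw [h2]
  exact le_of_tendsto_of_tendsto' (tendsto_singularSeriesPartial_holds _)
    (tendsto_singularSeriesPartial_holds _) (singularSeriesPartial_pair_le hh h0)

/-! ## §4 (b) Boundary shifts: odd `h` is free, `h = 0` is false -/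

theorem P_nonneg (h N : ℕ) : 0 ≤ P h N :=
  Finset.sum_nonneg fun _ _ => mul_nonneg ArithmeticFunction.vonMangoldt_nonneg
    ArithmeticFunction.vonMangoldt_nonneg

theorem eq_two_pow_of_isPrimePow_of_even {n : ℕ} (hn : IsPrimePow n) (he : Even n) :
    ∃ k, n = 2 ^ k := by
  rw [isPrimePow_nat_iff] at hn
  obtain ⟨p, k, hp, _, rfl⟩ := hn
  have h2 : 2 ∣ p := Nat.prime_two.dvd_of_dvd_pow (even_iff_two_dvd.mp he)
  have : p = 2 := ((Nat.prime_dvd_prime_iff_eq Nat.prime_two hp).mp h2).symm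
  exact ⟨k, by rw [this]⟩

/-- For odd `h`, a non-zero term `Λ(n)Λ(n+h)` forces `n` or `n + h` to be a power of two. -/
theorem term_support_odd {h n : ℕ} (hh : Odd h) (hn : Λ n * Λ (n + h) ≠ 0) :
    (∃ k, n = 2 ^ k) ∨ (∃ k, n + h = 2 ^ k) := by
  have h1 : IsPrimePow n :=
    ArithmeticFunction.vonMangoldt_ne_zero_iff.mp (left_ne_zero_of_mul hn)
  have h2 : IsPrimePow (n + h) :=
    ArithmeticFunction.vonMangoldt_ne_zero_iff.mp (right_ne_zero_of_mul hn)
  rcases Nat.even_or_odd n with he | ho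
  · exact Or.inl (eq_two_pow_of_isPrimePow_of_even h1 he)
  · exact Or.inr (eq_two_pow_of_isPrimePow_of_even h2 (ho.add_odd hh))

/-- Odd shifts: `P h N ≤ 2 (log₂(N+h) + 1) · log²(N+h)`. -/
theorem P_le_of_odd {h : ℕ} (hh : Odd h) (N : ℕ) :
    P h N ≤ 2 * ((Nat.log 2 (N + h) : ℝ) + 1) * Real.log ((N + h : ℕ) : ℝ) ^ 2 := by
  classical
  set K := Nat.log 2 (N + h) with hK
  set T : Finset ℕ := (Icc 1 N).filter (fun n => Λ n * Λ (n + h) ≠ 0) with hT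
  have hsum : P h N = ∑ n ∈ T, Λ n * Λ (n + h) := (Finset.sum_filter_ne_zero _).symm
  have hsub : T ⊆ (range (K + 1)).image (fun k => 2 ^ k) ∪ (range (K + 1)).image (fun k => 2 ^ k - h) := by
    intro n hn
    rw [hT, Finset.mem_filter, Finset.mem_Icc] at hn
    obtain ⟨⟨_, hnN⟩, hne⟩ := hn
    rcases term_support_odd hh hne with ⟨k, hk⟩ | ⟨k, hk⟩
    · apply Finset.mem_union_left
      rw [Finset.mem_image]
      refine ⟨k, Finset.mem_range.mpr (Nat.lt_succ_of_le ?_), hk.symm⟩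
      exact Nat.le_log_of_pow_le one_lt_two (by omega)
    · apply Finset.mem_union_right
      rw [Finset.mem_image]
      refine ⟨k, Finset.mem_range.mpr (Nat.lt_succ_of_le ?_), by omega⟩
      exact Nat.le_log_of_pow_le one_lt_two (by omega)
  have hcardN : T.card ≤ (K + 1) + (K + 1) :=
    calc T.card ≤ ((range (K + 1)).image (fun k => 2 ^ k) ∪ (range (K + 1)).image (fun k => 2 ^ k - h)).card :=
          Finset.card_le_card hsub
      _ ≤ ((range (K + 1)).image (fun k => 2 ^ k)).card + ((range (K + 1)).image (fun k => 2 ^ k - h)).card :=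
          Finset.card_union_le _ _
      _ ≤ (K + 1) + (K + 1) := add_le_add (Finset.card_image_le.trans (by simp))
          (Finset.card_image_le.trans (by simp))
  have hcard : (T.card : ℝ) ≤ 2 * ((K : ℝ) + 1) := by
    have : (T.card : ℝ) ≤ ((K + 1 + (K + 1) : ℕ) : ℝ) := by exact_mod_cast hcardN
    push_cast at this
    linarith
  have hlog0 : 0 ≤ Real.log ((N + h : ℕ) : ℝ) := Real.log_natCast_nonneg _
  have hterm : ∀ n ∈ T, Λ n * Λ (n + h) ≤ Real.log ((N + h : ℕ) : ℝ) ^ 2 := by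
    intro n hn
    rw [hT, Finset.mem_filter, Finset.mem_Icc] at hn
    obtain ⟨⟨hn1, hnN⟩, _⟩ := hn
    have hn0 : (0 : ℝ) < n := by exact_mod_cast hn1
    have hlogn : Real.log n ≤ Real.log ((N + h : ℕ) : ℝ) :=
      Real.log_le_log hn0 (by exact_mod_cast (by omega : n ≤ N + h))
    have hlognh : Real.log ((n + h : ℕ) : ℝ) ≤ Real.log ((N + h : ℕ) : ℝ) :=
      Real.log_le_log (by exact_mod_cast (by omega : 0 < n + h))
        (by exact_mod_cast (by omega : n + h ≤ N + h))
    have h0 : 0 ≤ Real.log (n : ℝ) := Real.log_natCast_nonneg _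
    calc Λ n * Λ (n + h) ≤ Real.log n * Real.log ((n + h : ℕ) : ℝ) :=
          mul_le_mul ArithmeticFunction.vonMangoldt_le_log ArithmeticFunction.vonMangoldt_le_log
            ArithmeticFunction.vonMangoldt_nonneg h0
      _ ≤ Real.log ((N + h : ℕ) : ℝ) * Real.log ((N + h : ℕ) : ℝ) :=
          mul_le_mul hlogn hlognh (Real.log_natCast_nonneg _) hlog0
      _ = Real.log ((N + h : ℕ) : ℝ) ^ 2 := (sq _).symm
  calc P h N = ∑ n ∈ T, Λ n * Λ (n + h) := hsum
    _ ≤ ∑ n ∈ T, Real.log ((N + h : ℕ) : ℝ) ^ 2 := Finset.sum_le_sum hterm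
    _ = T.card * Real.log ((N + h : ℕ) : ℝ) ^ 2 := by rw [Finset.sum_const, nsmul_eq_mul]
    _ ≤ 2 * ((K : ℝ) + 1) * Real.log ((N + h : ℕ) : ℝ) ^ 2 := by gcongr

/-- Odd shifts, clean form: `P h N ≤ 48 (log N)³` for `N ≥ max h 3`. -/
theorem P_le_log_cube_of_odd {h : ℕ} (hh : Odd h) {N : ℕ} (hN3 : 3 ≤ N) (hNh : h ≤ N) :
    P h N ≤ 48 * Real.log N ^ 3 := by
  have hM0 : (N + h : ℕ) ≠ 0 := by omega
  set L := Real.log ((N + h : ℕ) : ℝ) with hL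
  have hlog2 : (1 : ℝ) / 2 < Real.log 2 := by have := Real.log_two_gt_d9; linarith
  have hlog2' : Real.log 2 < 1 := by have := Real.log_two_lt_d9; linarith
  -- K ≤ L / log 2 ≤ 2 L
  have hK : (Nat.log 2 (N + h) : ℝ) ≤ 2 * L := by
    have hpow : ((2 : ℕ) ^ Nat.log 2 (N + h) : ℕ) ≤ N + h := Nat.pow_log_le_self 2 hM0
    have hpow' : (2 : ℝ) ^ (Nat.log 2 (N + h)) ≤ ((N + h : ℕ) : ℝ) := by exact_mod_cast hpow
    have hlogle : (Nat.log 2 (N + h) : ℝ) * Real.log 2 ≤ L := by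
      rw [hL, ← Real.log_pow]
      exact Real.log_le_log (by positivity) hpow'
    have hK0 : (0 : ℝ) ≤ Nat.log 2 (N + h) := Nat.cast_nonneg _
    nlinarith
  -- L ≥ 1 and L ≤ 2 log N
  have hN3' : (3 : ℝ) ≤ N := by exact_mod_cast hN3
  have hlogN1 : 1 ≤ Real.log N := by
    rw [← Real.log_exp 1]
    refine Real.log_le_log (Real.exp_pos 1) (le_trans ?_ hN3')
    have := Real.exp_one_lt_d9; linarith
  have hLle : L ≤ 2 * Real.log N := by
    have hNh' : ((N + h : ℕ) : ℝ) ≤ 2 * N := by push_cast; exact_mod_cast (by omega : N + h ≤ 2 * N)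
    calc L ≤ Real.log (2 * N) := Real.log_le_log (by positivity) hNh'
      _ = Real.log 2 + Real.log N := Real.log_mul (by norm_num) (by positivity)
      _ ≤ 2 * Real.log N := by linarith
  have hL1 : 1 ≤ L := by
    calc (1 : ℝ) ≤ Real.log N := hlogN1
      _ ≤ L := Real.log_le_log (by positivity) (by exact_mod_cast (by omega : N ≤ N + h))
  have hL0 : 0 ≤ L := by linarith
  calc P h N ≤ 2 * ((Nat.log 2 (N + h) : ℝ) + 1) * L ^ 2 := P_le_of_odd hh N
    _ ≤ 2 * (2 * L + L) * L ^ 2 := by gcongr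
    _ = 6 * L ^ 3 := by ring
    _ ≤ 6 * (2 * Real.log N) ^ 3 := by gcongr
    _ = 48 * Real.log N ^ 3 := by ring

/-- **Odd shifts are free**: for odd `h` the conclusion `Concl h` holds UNCONDITIONALLY
(`𝔖({0,h}) = 0` and `P h N = O(log³ N) = o(N)`). -/
theorem concl_odd {h : ℕ} (hh : Odd h) : Concl h := by
  have hlo : (fun N : ℕ => Real.log N ^ 3) =o[atTop] fun N : ℕ => (N : ℝ) :=
    Real.isLittleO_pow_log_id_atTop.comp_tendsto tendsto_natCast_atTop_atTop
  have hbig : (fun N : ℕ => P h N) =O[atTop] fun N : ℕ => Real.log N ^ 3 := by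
    refine IsBigO.of_bound 48 ?_
    filter_upwards [eventually_ge_atTop (max h 3)] with N hN
    have hN3 : 3 ≤ N := le_of_max_le_right hN
    have hNh : h ≤ N := le_of_max_le_left hN
    have hlog0 : 0 ≤ Real.log (N : ℝ) := Real.log_natCast_nonneg _
    rw [Real.norm_of_nonneg (P_nonneg h N), Real.norm_of_nonneg (pow_nonneg hlog0 3)]
    exact P_le_log_cube_of_odd hh hN3 hNh
  have : (fun N : ℕ => P h N) =o[atTop] fun N : ℕ => (N : ℝ) := hbig.trans_isLittleO hlo
  refine this.congr' ?_ EventuallyEq.rfl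
  filter_upwards with N
  rw [HL_odd hh, zero_mul, sub_zero]

/-- `PairsHL` reduces to even shifts. -/
theorem pairsHL_iff_even : PairsHL ↔ ∀ h : ℕ, 1 ≤ h → Even h → Concl h := by
  rw [pairsHL_iff]
  refine ⟨fun H h h1 _ => H h h1, fun H h h1 => ?_⟩
  rcases Nat.even_or_odd h with he | ho
  · exact H h h1 he
  · exact concl_odd ho

/-- The crux reduces to even shifts. -/
theorem crux_iff_even :
    EngineToPairs ↔
      (DilatedTableChowla → TypeI2Dilated → ElliottHalberstam → ∀ h : ℕ, 1 ≤ h → Even h → Concl h) := by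
  rw [crux_iff_pairsHL, pairsHL_iff_even]

/-- `P 0 N = Σ_{n ≤ N} Λ(n)²`. -/
theorem P_zero_eq (N : ℕ) : P 0 N = ∑ n ∈ Icc 1 N, Λ n ^ 2 := by
  simp [P, sq]

/-- Chebyshev-type lower bound at the excluded shift: `Σ_{n ≤ N} Λ(n)² ≥ N log N / 8` for `N ≥ 2²⁴`. -/
theorem P_zero_ge {N : ℕ} (hN : 2 ^ 24 ≤ N) : (N : ℝ) * Real.log N / 8 ≤ P 0 N := by
  classical
  set s := Nat.sqrt N with hs
  have hsN : s ≤ N := Nat.sqrt_le_self N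
  have hsub : Nat.primesLE s ⊆ Nat.primesLE N := Nat.primesLE_mono hsN
  set Q := Nat.primesLE N \ Nat.primesLE s with hQ
  -- the Chebyshev inputs
  have hθN : (N : ℝ) * Real.log 2 / 2 ≤ ∑ p ∈ Nat.primesLE N, Real.log p := by
    rw [← Chebyshev.theta_eq_sum_primesLE_log]
    exact Literature.Computability.Complexity.SmallPrimes.theta_ge_half hN
  have hθs : ∑ p ∈ Nat.primesLE s, Real.log p ≤ Real.log 4 * s := by
    rw [← Chebyshev.theta_eq_sum_primesLE_log]
    exact Chebyshev.theta_le_log4_mul_x (Nat.cast_nonneg s)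
  have hsplit : ∑ p ∈ Q, Real.log p = ∑ p ∈ Nat.primesLE N, Real.log p - ∑ p ∈ Nat.primesLE s, Real.log p := by
    rw [hQ, ← Finset.sum_sdiff hsub]; ring
  -- s ≤ N / 2^12
  have hs12 : (2 ^ 12 : ℕ) ≤ s := by
    rw [hs, Nat.le_sqrt]
    calc 2 ^ 12 * 2 ^ 12 = 2 ^ 24 := by norm_num
      _ ≤ N := hN
  have hsR : (s : ℝ) * 2 ^ 12 ≤ N := by
    have h1 : s * s ≤ N := Nat.sqrt_le N
    have h2 : s * 2 ^ 12 ≤ s * s := Nat.mul_le_mul_left s hs12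
    exact_mod_cast h2.trans h1
  have hlog4 : Real.log 4 < 2 := by
    have : Real.log 4 = 2 * Real.log 2 := by
      rw [show (4 : ℝ) = 2 ^ 2 by norm_num, Real.log_pow]; norm_num
    rw [this]; have := Real.log_two_lt_d9; linarith
  have hlog2 : (0.69 : ℝ) < Real.log 2 := by have := Real.log_two_gt_d9; linarith
  have hN0 : (0 : ℝ) < N := by exact_mod_cast (lt_of_lt_of_le (by norm_num) hN)
  -- Σ_{Q} log p ≥ N/4
  have hQsum : (N : ℝ) / 4 ≤ ∑ p ∈ Q, Real.log p := by
    rw [hsplit]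
    have hs0 : (0 : ℝ) ≤ s := Nat.cast_nonneg s
    nlinarith
  -- termwise: for p ∈ Q, (log p)^2 ≥ (log N / 2) log p
  have hlogN0 : 0 ≤ Real.log (N : ℝ) := Real.log_natCast_nonneg _
  have hterm : ∀ p ∈ Q, Real.log N / 2 * Real.log p ≤ Λ p * Λ (p + 0) := by
    intro p hp
    rw [hQ, Finset.mem_sdiff, Nat.mem_primesLE, Nat.mem_primesLE] at hp
    obtain ⟨⟨hpN, hpp⟩, hps⟩ := hp
    have hsp : s < p := by
      by_contra hle
      exact hps ⟨not_lt.mp hle, hpp⟩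
    have hp2 : N < p * p := by
      have := Nat.sqrt_lt'.mp hsp  -- ?
      calc N < (s + 1) * (s + 1) := Nat.lt_succ_sqrt N
        _ ≤ p * p := Nat.mul_le_mul hsp hsp
    have hp0 : (0 : ℝ) < p := by exact_mod_cast hpp.pos
    have hlogp : Real.log N ≤ 2 * Real.log p := by
      have hlp : Real.log ((p : ℝ) ^ 2) = 2 * Real.log p := by
        rw [Real.log_pow]; norm_num
      rw [← hlp]
      refine Real.log_le_log hN0 ?_
      exact_mod_cast (by nlinarith : N ≤ p ^ 2)
    have hlp0 : 0 ≤ Real.log (p : ℝ) := Real.log_natCast_nonneg _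
    rw [add_zero, ArithmeticFunction.vonMangoldt_apply_prime hpp]
    nlinarith
  have hQsub : Q ⊆ Icc 1 N := by
    intro p hp
    rw [hQ, Finset.mem_sdiff, Nat.mem_primesLE] at hp
    exact Finset.mem_Icc.mpr ⟨hp.1.2.one_le, hp.1.1⟩
  calc (N : ℝ) * Real.log N / 8 = Real.log N / 2 * (N / 4) := by ring
    _ ≤ Real.log N / 2 * ∑ p ∈ Q, Real.log p := by gcongr
    _ = ∑ p ∈ Q, Real.log N / 2 * Real.log p := by rw [Finset.mul_sum]
    _ ≤ ∑ p ∈ Q, Λ p * Λ (p + 0) := Finset.sum_le_sum hterm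
    _ ≤ ∑ n ∈ Icc 1 N, Λ n * Λ (n + 0) :=
        Finset.sum_le_sum_of_subset_of_nonneg hQsub fun _ _ _ =>
          mul_nonneg ArithmeticFunction.vonMangoldt_nonneg ArithmeticFunction.vonMangoldt_nonneg
    _ = P 0 N := rfl

/-- **`h = 0` is excluded for cause**: the conclusion at the shift `0` reads `Σ_{n≤N} Λ(n)² = N + o(N)`
and is FALSE (`Σ Λ² ≥ N log N / 8`). So the clause `1 ≤ h` of the crux is load-bearing. -/
theorem not_concl_zero : ¬ Concl 0 := by
  intro hC
  rw [Concl, HL_zero] at hC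
  have hev := hC.def (by norm_num : (0 : ℝ) < 1 / 2)
  obtain ⟨N, hb, hN⟩ := (hev.and (eventually_ge_atTop (2 ^ 24))).exists
  have hlow := P_zero_ge hN
  have hN0 : (0 : ℝ) < N := by exact_mod_cast (lt_of_lt_of_le (by norm_num) hN)
  rw [one_mul, Real.norm_eq_abs, Real.norm_of_nonneg hN0.le] at hb
  have hup : P 0 N ≤ 3 / 2 * N := by
    have := (abs_le.mp hb).2; linarith
  -- log N ≥ 24 log 2 > 16
  have hlogN : (16 : ℝ) ≤ Real.log N := by
    have h2 : (2 : ℝ) ^ 24 ≤ N := by exact_mod_cast hN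
    have := Real.log_le_log (by positivity) h2
    rw [Real.log_pow] at this
    have := Real.log_two_gt_d9
    push_cast at *
    nlinarith
  nlinarith

/-- No version of the conclusion can include the shift `0`. -/
theorem not_forall_concl : ¬ ∀ h : ℕ, Concl h := fun H => not_concl_zero (H 0)

/-- (a) Dropping `1 ≤ h` makes the crux FALSE modulo its hypotheses. -/
theorem withoutShiftPos_false_of_hyps (hD : DilatedTableChowla) (hI : TypeI2Dilated)
    (hE : ElliottHalberstam) : ¬ WithoutShiftPos := fun H => not_concl_zero (H hD hI hE 0)

/-! ## §5 (c) A natural strengthening refuted: no uniformity in the shift -/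

/-- The conclusion, uniformly in the shift `h ≥ 1` (a natural strengthening). -/
def UniformConcl : Prop :=
  ∀ ε : ℝ, 0 < ε → ∀ᶠ N : ℕ in atTop, ∀ h : ℕ, 1 ≤ h → |P h N - HL h * N| ≤ ε * N

/-- At the factorial shift `h = (N!)²` every term of `P h N` vanishes: if `n = p^j ≤ N` then
`p^{j+1} ∣ (N!)²`, so `p^j + (N!)² = p^j (1 + (N!)²/p^j)` with the cofactor `≡ 1 (mod p)`, not a prime
power. -/
theorem P_factorial_sq (N : ℕ) : P ((Nat.factorial N) ^ 2) N = 0 := by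
  apply Finset.sum_eq_zero
  intro n hn
  rw [Finset.mem_Icc] at hn
  by_contra hne
  have h1 : IsPrimePow n :=
    ArithmeticFunction.vonMangoldt_ne_zero_iff.mp (left_ne_zero_of_mul hne)
  have h2 : IsPrimePow (n + (Nat.factorial N) ^ 2) :=
    ArithmeticFunction.vonMangoldt_ne_zero_iff.mp (right_ne_zero_of_mul hne)
  rw [isPrimePow_nat_iff] at h1 h2
  obtain ⟨p, j, hp, hj, rfl⟩ := h1
  obtain ⟨q, i, hq, hi, hqi⟩ := h2
  set F := (Nat.factorial N) ^ 2 with hF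
  have hpjF : p ^ j ∣ Nat.factorial N := Nat.dvd_factorial (pow_pos hp.pos j) hn.2
  have hF2 : p ^ (2 * j) ∣ F := by
    rw [hF, pow_mul']
    exact pow_dvd_pow_of_dvd hpjF 2
  have hFj1 : p ^ (j + 1) ∣ F := (pow_dvd_pow p (by omega : j + 1 ≤ 2 * j)).trans hF2
  have hpF : p ∣ F := (dvd_pow_self p (by omega : j + 1 ≠ 0)).trans hFj1
  -- p ∣ q^i hence p = q
  have hpqi : p ∣ q ^ i := by
    rw [hqi]
    exact dvd_add (dvd_pow_self p hj.ne') hpF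
  have hpq : p = q := (Nat.prime_dvd_prime_iff_eq hp hq).mp (hp.dvd_of_dvd_pow hpqi)
  subst hpq
  -- i > j
  have hij : j < i := by
    have hlt : p ^ j < p ^ i := by
      rw [hqi]
      have : 0 < F := by positivity
      omega
    exact (Nat.pow_lt_pow_iff_right hp.one_lt).mp hlt
  -- p^(j+1) ∣ p^i = p^j + F and p^(j+1) ∣ F ⇒ p^(j+1) ∣ p^j
  have hdiv : p ^ (j + 1) ∣ p ^ j := by
    have h3 : p ^ (j + 1) ∣ p ^ j + F := by
      rw [← hqi]; exact pow_dvd_pow p (by omega)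
    obtain ⟨c, hc⟩ := h3
    obtain ⟨d, hd⟩ := hFj1
    refine ⟨c - d, ?_⟩
    rw [Nat.mul_sub, ← hc, ← hd]
    omega
  have := (Nat.pow_dvd_pow_iff_le_right hp.one_lt).mp hdiv
  omega

/-- **No uniformity in the shift**: the strengthening `UniformConcl` is FALSE. -/
theorem not_uniformConcl : ¬ UniformConcl := by
  intro H
  obtain ⟨N, hN, hN2⟩ := ((H (1 / 2) (by norm_num)).and (eventually_ge_atTop 2)).exists
  set h := (Nat.factorial N) ^ 2 with hh
  have hfac2 : 2 ∣ Nat.factorial N := Nat.dvd_factorial two_pos hN2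
  have heven : Even h := by
    rw [hh, even_iff_two_dvd]
    exact hfac2.trans (dvd_pow_self _ two_ne_zero)
  have h0 : h ≠ 0 := pow_ne_zero 2 (Nat.factorial_pos N).ne'
  have h1 : 1 ≤ h := Nat.one_le_iff_ne_zero.mpr h0
  have hb := hN h h1
  rw [hh, P_factorial_sq N, ← hh, zero_sub, abs_neg] at hb
  have hHL : 1 ≤ HL h := one_le_HL_two.trans (HL_two_le_HL_even heven h0)
  have hN0 : (0 : ℝ) < N := by exact_mod_cast (lt_of_lt_of_le two_pos hN2)
  rw [abs_of_nonneg (mul_nonneg (HL_nonneg h) hN0.le)] at hb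
  nlinarith

end Summit.Parity.GeneralizedHardyLittlewood.Cruxes.EngineToPairs.Disproof

end
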